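import Summits.QuantumFields.YangMills.Theorems.BalabanUVNodesN11OmegaTopAtRePinH
import Summits.QuantumFields.YangMills.Theorems.BalabanUVNodesN11NoExpansionRoughFibre
import Summits.QuantumFields.YangMills.Theorems.BalabanUVNodesN11AllSmallEmptyExtUnitBranch
import Summits.QuantumFields.YangMills.Theorems.BalabanUVNodesN11SmallRegFirstStepFails

/-!
# DAG node N11 — ON THE ROUGH COARSE FIELDS THE MAIN TERM's 𝐓-SLOT VANISHES, SO ITS (O3′) CLAUSE TESTS THE NEW-SIDE PREFACTOR THERE; AT THIS SEAT's RE-PINNED WITNESS `rePinH θ`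
# THE TEST READS «`c₀ = 0` OR the rough all-(3.2)-small coarse fields are null OR the main term's 𝐓-slot is the zero function», and that set is non-null as soon as ONE strictly
# cube-rough coarse field exists — a kernel NECESSARY CONDITION for the top pair of N11's first 𝐓-law (count-neutral, LOCATED)

HEADER — WORK-UNIT METADATA.  Cell `pub-ymgap`, YM-PLAN Track A (HUMAN RULING D-0062), seat `pub-ymgap-dag-n11-d` (g18; N11 [B14], s2), route `BalabanUVNodes`, item K1⁹ =
stmt-QuantumFields-27364 (helper lane, `--kind proof --supports 27364 --as helper`, count-neutral).  [III] = [Balaban1988Convergent], [B7] = [Balaban1985Averaging].  Over this seat's g18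
`…N11TopChildStepWeight` ∕ `…N11TopChildO3AtRecord13` ∕ `…N11OmegaTopAtRePinH` (the top pair's weight, its (O3′) clause, the re-pinned prefactor `c₀`), g4 `…N11NoExpansionRoughFibre` (the
pattern: a cut-off family agreeing with zero on the averaging graph has a.e.-zero transport on the cut), g5 `Node00.StepWeightsAtNoExpansion` (`not_smallApproxFluct_zero_of_chiFactor_eq_one_of_rough`,
`plaqBonds_subset_bondsStar_zero`), seat dag-n21-c's PROVED [B7] Prop. 2 (`plaqSmall_iter_avOfRecord_level`), g3's fibre lemma `transportK_congr_ae_of_fibre`.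

WHY THIS FILE.  `…N11TopChildO3AtRecord13.firstStep_O3_top_iff` displays the main term of N11's first 𝐓-law as ONE a.e. identity on `{all χ₁-cubes (3.2)-small at V′}`: old side
`∫dU δ(ŪV′⁻¹)[χ′_0(ALL)(U,V′)·Σ_S ζ_1(∅,∅,(∅,S))(U,V′)·ρ₀(U)](V′)`, new side `ζ_0(∅)w_0(base₁V′)·exp A_1(U_1(V′))`.  On a coarse field `V′` all of whose χ₁-cubes are (3.2)-small but which is
itself ROUGH (`¬PlaqSmall (2α₀(Lη₁)²) V′`), the OLD SIDE VANISHES: on the fibre `Ū = V′`, «all (3.3)-small» would make the fine field `U` bondwise `2δ₀`-close to the `ε₁η₁²`-flat localized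
backgrounds, hence `(ε₁η₁² + 8δ₀)`-plaquette-small (g5), hence `Ū` `2α₀(Lη₁)²`-small by [B7] Prop. 2 (n21-c) for `ε₁η₁² + 8δ₀ ≤ α₀η₁²` — contradiction; so `χ′_0(ALL)(U, Ū) = 0` on that fibre
and the transport is `0` for a.e. such `V′` (g3's fibre lemma; no fibre positivity needed).  Consequently (O3′) at the top pair TESTS THE NEW-SIDE PREFACTOR on the rough part of its support:
`ζ_0(∅)w_0(base₁V′)·exp A_1(U_1(V′)) = 0` a.e. there, i.e. `ζ_0(∅)(base₁V′)·w_0(𝕋,∅,∅)(base₁V′) = 0` a.e. there — unless the 𝐓-slot is the zero function.  At `rePinH θ` the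
prefactor is the CONSTANT `c₀ = 1 − w_0(s′^{all-large}_1)(1, 1̄)` (`…OmegaTopAtRePinH`): so `c₀ = 0` (then the §2-form slot is the zero function) OR the rough all-(3.2)-small coarse fields
are `dV′`-null OR the 𝐓-slot is identically zero — THE MAIN TERM IS ABSENT at `rePinH θ` once that set is non-null, and it is as soon as ONE coarse field strictly `2εreg`-rough near every
χ₁-cube exists (§3: g5's OPEN set `isOpen_cubeRoughCoarse_lt`, on def-R's unit branch where the (3.2) indicators are `1` — g8 — charged by product Haar measure,
`isOpenPosMeasure_fieldMeasure_SU`; and ONE EXISTS once `SU(N)` has an element beyond the threshold — g5's `fieldMeasure_cubeRough_inter_preimage_pos`).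

WHAT THIS FILE PROVES (0 `def`, 0 `sorry`, standard axioms).  §1 `plaqSmall_mono` · `chiFactor_eq_one_of_prod_ne_zero` · `smallApproxFluct_of_chiPrime_univ_ne_zero` ·
★ `plaqSmall_of_chiPrime_univ_ne_zero_of_prod_chiFactor_ne_zero` (all (3.2)- and (3.3)-small ⇒ the OLD field is `(ε₁η₁² + 8δ₀)`-plaquette-small) · ★★ `chiPrime_univ_avg_eq_zero_of_rough`
(Prop. 2: over a ROUGH average with all cubes (3.2)-small, `χ′_0(ALL)(U, Ū) = 0`).  §2 ★★★ `slotsT_one_top_ae_zero_on_rough` (every `θ`, every residual: the top pair's 𝐓-slot vanishes for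
a.e. rough `V′`).  §3 `chiSeqOfRecord_one_eq_one_of_cubeRough` · `not_plaqSmall_of_cubeRough` · ★ `rough_support_ne_zero_of_exists_cubeRoughStrict` · ★ `exists_cubeRoughStrict_of_lt_dist1`.
§4 ★★★ `top_prefactor_ae_zero_on_rough_of_O3` ((O3′) at the top pair ⇒ `slotT ≡ 0 ∨ ζ_0(∅)·w_0(𝕋,∅,∅)(base₁V′) = 0` a.e. on the rough part of the support) · ★★★ `rePinH_top_O3_trichotomy`
(at `rePinH θ`: `slotT ≡ 0 ∨ c₀ = 0 ∨ {rough ∧ χ₁(s_top) ≠ 0}` is null) · ★★★ `rePinH_main_term_absent_of_O3` (that set non-null ⇒ the 𝐓-slot vanishes a.e. on its support) · ★★★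
`rePinH_main_term_absent_of_O3_of_exists_cubeRoughStrict` (the same from ONE strictly cube-rough coarse field, `2α₀(Lη₁)² ≤ 2εreg`).

HONEST FRAMING.  A NECESSARY-CONDITION reading on the tree's own objects (count-neutral, LOCATED): nothing of Bałaban asserted or refuted (print's ζ(∅) = 1 and its backgrounds are [15]'s
small minimisers; the tree's `c₀` and unit branch are typing artefacts of the pins); K1⁹'s `∃θ` untouched (other pins possible); the strictly cube-rough witness `V₀` is DISPLAYED (the A6
binder of g8 ∕ dag-n11-e), not constructed; N11 NOT discharged; K1⁹ NOT closed; no registered stub touched; counts unmoved (typed 28∕28 · discharged 5∕27 · A 5∕28).  One finite `𝕋⁴_{L^K}` programme at fixed `ε = L^{−K}` —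
NOT ℝ⁴, NOT OS, NOT a mass gap, NOT Clay.  No `sorry`, `axiom`, `def`, `instance`, `notation`.  Sources (SHAPE only): [III] (3.1)–(3.5) pp.264–265, (3.16) p.268, (3.25) p.270, (2.12)
p.256, (2.16)–(2.17) p.257, Thm 1 p.262; [B7] Prop. 2 (52)–(54) p.26, (10) p.19; [I] = [Balaban1987RG1] Thm 1 p.259.
-/

noncomputable section

open MeasureTheory
open scoped BigOperators Matrix.Norms.L2Operator

namespace Summit.QuantumFields.YangMills.Theorems.BalabanUVNodesN11TopPairRoughSet

open Literature.MathematicalPhysics.QuantumFieldTheory.Balaban1983to89 T4Continuum Node00 Node00.Tk B14.Eq218Concrete B14.Sect3Decomp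
open Literature.MathematicalPhysics.QuantumFieldTheory.Balaban1983to89.T4AveragingDisintegration (transportK kernelTransport)
open Literature.MathematicalPhysics.QuantumFieldTheory.Balaban1983to89.ExpMeanLog (deltaSU)
open Summit.QuantumFields.YangMills.Theorems.N21AveragedDatumRegularity (plaqSmall_iter_avOfRecord_level)
open B15Claim189CubePin (cubeOfSite cubeOfSite_mem_cubeIndices plaq_mem_plaqInside_cubeEnl_src)
open GaugeField (plaqHol)
open B15DeterminingSets (pts)
open B14.Eq213MaximalDomains (side)
open BalabanUVNodesN11TopChildStepWeight (wOfRecord_top_eq_prod chiSeqOfRecord_succ_top_eq_prod)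
open BalabanUVNodesN11TopChildO3AtRecord13 (firstStep_O3_top_iff)
open BalabanUVNodesN11RePinnedParamDefs (rePinH)
open BalabanUVNodesN11OmegaTopAtRePinH (WtOfRecord₁₃H_rePinH_ζ_zero_empty_baseCfg WtOfRecord₁₃H_rePinH_w_univ_empty)
open BalabanUVNodesN11AllLargeFieldLabel (sideD_pos sideχ_pos)

variable {F : T4Family} {N : ℕ} [NeZero N]

/-! ## §1. All (3.2)- and (3.3)-small ⇒ the old field is plaquette-small ⇒ its average is not rough -/

section Small

variable (ν : Stage7Numerics) (M : ℕ) (A₁ : ℝ) (p : B12.RunParams) (g : ℕ → ℝ)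

/-- Monotonicity of the small-plaquette predicate in the threshold. [cite: Balaban1987RG1, (0.18) p.255 (bookkeeping)] -/
theorem plaqSmall_mono {j : ℕ} {δ δ' : ℝ} (hδ : δ ≤ δ') {U : GaugeField (F.P p.K) j (SU N)} (h : PlaqSmall δ U) : PlaqSmall δ' U :=
  fun q => lt_of_lt_of_le (h q) hδ

/-- A non-vanishing product of (3.2) factors has every factor `= 1` (`{0,1}`-valued factors). [cite: Balaban1988Convergent, (3.2) p.265 (bookkeeping)] -/
theorem chiFactor_eq_one_of_prod_ne_zero {k : ℕ} (V' : GaugeField (F.P p.K) (k + 1) (SU N)) (h : (∏ c : Iχ F ν p g k, chiFactor F N ν p g k c V') ≠ 0)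
    (c : Iχ F ν p g k) : chiFactor F N ν p g k c V' = 1 := by
  have hc : chiFactor F N ν p g k c V' ≠ 0 := fun h0 => h (Finset.prod_eq_zero (Finset.mem_univ c) h0)
  have h3 : chiFactor F N ν p g k c V' * (chiFactor F N ν p g k c V' - 1) = 0 := by rw [mul_sub, mul_one, chiFactor_mul_self, sub_self]
  rcases mul_eq_zero.1 h3 with h4 | h4   -- an idempotent nonzero real is `1`
  exacts [absurd h4 hc, by linarith]

/-- A non-vanishing `χ′_k(ALL cubes)(U, V′)` has every cube (3.3)-small. [cite: Balaban1988Convergent, (3.3) p.265 (bookkeeping)] -/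
theorem smallApproxFluct_of_chiPrime_univ_ne_zero {k : ℕ} (s : SeqOfRecord F ν M g p.K k) (U : GaugeField (F.P p.K) k (SU N)) (V' : GaugeField (F.P p.K) (k + 1) (SU N))
    (h : chiPrime (sect3DataOfRecord F N ν M p g k s) (avOfRecord F N p.K) (2 * deltaOfRecord ν g k A₁) (Finset.univ : Finset (Iχ F ν p g k)) U V' ≠ 0)
    (c : Iχ F ν p g k) : SmallApproxFluct (sect3DataOfRecord F N ν M p g k s) (avOfRecord F N p.K) (2 * deltaOfRecord ν g k A₁) U V' c := by
  classical
  by_contra hc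
  apply h
  unfold chiPrime
  exact Finset.prod_eq_zero (Finset.mem_univ c) (by rw [if_neg hc])

/-- ★ **ALL (3.2)-SMALL AND ALL (3.3)-SMALL ⇒ THE OLD FIELD IS `(ε₁η₁² + 8δ₀)`-PLAQUETTE-SMALL** (first step; `0 < sideχ`): every plaquette lies inside the 1-collar of the χ₁-cube of its
source, whose localized background is `ε₁η₁²`-flat there, and `U` is `2δ₀`-close to it on the plaquette's four bonds (g5's lemma, contraposed). [cite: Balaban1988Convergent, (3.2)–(3.4) p.265, (2.16)–(2.17) p.257] -/
theorem plaqSmall_of_chiPrime_univ_ne_zero_of_prod_chiFactor_ne_zero (hχ : 0 < sideχ F ν p g 0) (s₀ : SeqOfRecord F ν M g p.K 0)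
    (U : GaugeField (F.P p.K) 0 (SU N)) (V' : GaugeField (F.P p.K) 1 (SU N)) (ha : (∏ c : Iχ F ν p g 0, chiFactor F N ν p g 0 c V') ≠ 0)
    (hb : chiPrime (sect3DataOfRecord F N ν M p g 0 s₀) (avOfRecord F N p.K) (2 * deltaOfRecord ν g 0 A₁) (Finset.univ : Finset (Iχ F ν p g 0)) U V' ≠ 0) :
    PlaqSmall (epsOfRecord ν g 1 * (F.P p.K).eta 1 ^ 2 + 4 * (2 * deltaOfRecord ν g 0 A₁)) U := by
  intro q
  set c : Iχ F ν p g 0 := ⟨cubeOfSite (sideχ F ν p g 0) q.src, cubeOfSite_mem_cubeIndices (sideχ F ν p g 0) hχ q.src⟩ with hc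
  have hq : q ∈ plaqInside (cubeEnl (F.P p.K) (sideχ F ν p g 0) c 1) := plaq_mem_plaqInside_cubeEnl_src (sideχ F ν p g 0) hχ q
  by_contra hlt
  exact not_smallApproxFluct_zero_of_chiFactor_eq_one_of_rough F N ν M A₁ p g s₀ c U V' (chiFactor_eq_one_of_prod_ne_zero ν p g V' ha c) hq (not_lt.1 hlt)
    (smallApproxFluct_of_chiPrime_univ_ne_zero ν M A₁ p g s₀ U V' hb c)

/-- ★★ **OVER A ROUGH AVERAGE WITH ALL CUBES (3.2)-SMALL, `χ′_0(ALL)(U, Ū) = 0`** ([B7] Prop. 2 at one step of the averaging of record, n21-c, contraposed; guards on `α₀` displayed, and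
`ε₁η₁² + 8δ₀ ≤ α₀η₁²`): a fine field all of whose cubes are (3.3)-small against the `ε₁η₁²`-flat backgrounds of its own average is `α₀η₁²`-plaquette-small, so its average is
`2α₀(Lη₁)²`-small. [cite: Balaban1985Averaging, Prop. 2 (53) p.26; Balaban1988Convergent, (3.2)–(3.3) p.265] -/
theorem chiPrime_univ_avg_eq_zero_of_rough (hχ : 0 < sideχ F ν p g 0) {α₀ : ℝ} (hα : 0 < α₀)
    (hα3 : (143 * (((((F.P p.K).d + 4 : ℕ) : ℝ)) ^ 2 / 4) ^ 2) * α₀ ≤ 1 / 3)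
    (hα2 : 2 * α₀ ≤ 2 * deltaSU (Fin N) / ((((F.P p.K).d + 4) * (F.P p.K).L : ℕ) : ℝ) ^ 2)
    (hαε : epsOfRecord ν g 1 * (F.P p.K).eta 1 ^ 2 + 4 * (2 * deltaOfRecord ν g 0 A₁) ≤ α₀ * (F.P p.K).eta 1 ^ 2)
    (s₀ : SeqOfRecord F ν M g p.K 0) (U : GaugeField (F.P p.K) 0 (SU N))
    (ha : (∏ c : Iχ F ν p g 0, chiFactor F N ν p g 0 c ((avOfRecord F N p.K 0).avg U)) ≠ 0)
    (hrough : ¬ PlaqSmall (2 * α₀ * (((F.P p.K).L : ℝ) ^ 1 * (F.P p.K).eta 1) ^ 2) ((avOfRecord F N p.K 0).avg U)) :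
    chiPrime (sect3DataOfRecord F N ν M p g 0 s₀) (avOfRecord F N p.K) (2 * deltaOfRecord ν g 0 A₁) (Finset.univ : Finset (Iχ F ν p g 0)) U ((avOfRecord F N p.K 0).avg U) = 0 := by
  by_contra hb
  have hU : PlaqSmall (α₀ * (F.P p.K).eta 1 ^ 2) U :=
    plaqSmall_mono p hαε (plaqSmall_of_chiPrime_univ_ne_zero_of_prod_chiFactor_ne_zero ν M A₁ p g hχ s₀ U _ ha hb)
  exact hrough (plaqSmall_iter_avOfRecord_level (F := F) (N := N) p.K 1 hα hα3 hα2 hU (le_refl 1))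

end Small

/-! ## §2. The top pair's 𝐓-slot vanishes for a.e. rough coarse field (every `θ`, every residual) -/

section SlotOnRough

variable (ν : Stage7Numerics) (τ : TowerNumerics) (E : B12.RunParams → ℝ) (A₁ : ℝ) (ζ : ZetaOfRecord F N ν τ.M) (ppSel : PpSelOfRecord F ν τ.M)
  (p : B12.RunParams) (g : ℕ → ℝ)

/-- ★★★ **THE MAIN TERM's 𝐓-SLOT VANISHES FOR a.e. ROUGH COARSE FIELD**: for a history `s′ = (𝕋, 𝕋)` of length 1, EVERY residual `ζ`, `0 < K`, `0 < sideD`, `0 < sideχ`, the `α₀` guards of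
[B7] Prop. 2 and `ε₁η₁² + 8δ₀ ≤ α₀η₁²`: `slotT_1(s′)(V′) = ∫dU δ(ŪV′⁻¹)[w_0(s′)(U,V′)·ρ₀(U)](V′) = 0` for `dV′`-a.e. `V′` with `¬PlaqSmall (2α₀(Lη₁)²) V′` — the integrand family cut off to the
rough coarse fields agrees with ZERO on the graph `V′ = Ū` (if some cube is (3.2)-large at `Ū` the weight vanishes by its front product; else §1). [cite: Balaban1988Convergent, (3.1)–(3.5) pp.264–265, (3.25) p.270; Balaban1985Averaging, Prop. 2 (53) p.26, (10) p.19] -/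
theorem slotsT_one_top_ae_zero_on_rough (hK : 0 < p.K) (hD : 0 < sideD F ν τ.M p g 0) (hχ : 0 < sideχ F ν p g 0) {α₀ : ℝ} (hα : 0 < α₀)
    (hα3 : (143 * (((((F.P p.K).d + 4 : ℕ) : ℝ)) ^ 2 / 4) ^ 2) * α₀ ≤ 1 / 3)
    (hα2 : 2 * α₀ ≤ 2 * deltaSU (Fin N) / ((((F.P p.K).d + 4) * (F.P p.K).L : ℕ) : ℝ) ^ 2)
    (hαε : epsOfRecord ν g 1 * (F.P p.K).eta 1 ^ 2 + 4 * (2 * deltaOfRecord ν g 0 A₁) ≤ α₀ * (F.P p.K).eta 1 ^ 2)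
    (s' : SeqOfRecord F ν τ.M g p.K 1) (hΩ : s'.Ω 1 = Set.univ) (hΛ : s'.Λ 1 = Set.univ) :
    ∀ᵐ V' ∂fieldMeasure (F.P p.K) 1 (SU N), ¬ PlaqSmall (2 * α₀ * (((F.P p.K).L : ℝ) ^ 1 * (F.P p.K).eta 1) ^ 2) V' →
      slotsTOfRecord F N ν τ E (wOfRecord F N ν τ.M A₁ ζ) ppSel p g 1 s' V' = 0 := by
  classical
  -- the family cut off to the rough coarse fields agrees with the zero family on the graph `V′ = Ū`
  have h := transportK_congr_ae_of_fibre (avOfRecord_measurable F N p.K 0) (avOfRecord_haarAC F N p.K 0 hK)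
    (f := fun (V' : GaugeField (F.P p.K) 1 (SU N)) (U : GaugeField (F.P p.K) 0 (SU N)) =>
      (if PlaqSmall (2 * α₀ * (((F.P p.K).L : ℝ) ^ 1 * (F.P p.K).eta 1) ^ 2) V' then (0 : ℝ) else 1) *
        (wOfRecord F N ν τ.M A₁ ζ p g 0 s' U V' * (chiSeqOfRecord F N ν τ.M g p.K 0 s'.init U * slotsOfRecord F N ν τ E (wOfRecord F N ν τ.M A₁ ζ) ppSel p g 0 s'.init U)))
    (g := fun _ _ => (0 : ℝ)) (fun U => by
      by_cases hs : PlaqSmall (2 * α₀ * (((F.P p.K).L : ℝ) ^ 1 * (F.P p.K).eta 1) ^ 2) ((avOfRecord F N p.K 0).avg U)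
      · simp only [hs, if_true, zero_mul]
      · rw [wOfRecord_top_eq_prod F N ν τ.M A₁ p g 0 ζ hD s' hΩ hΛ U ((avOfRecord F N p.K 0).avg U)]
        by_cases ha : (∏ c : Iχ F ν p g 0, chiFactor F N ν p g 0 c ((avOfRecord F N p.K 0).avg U)) = 0
        · rw [ha, zero_mul, zero_mul, zero_mul, mul_zero]
        · rw [chiPrime_univ_avg_eq_zero_of_rough ν τ.M A₁ p g hχ hα hα3 hα2 hαε s'.init U ha hs, mul_zero, zero_mul, zero_mul, mul_zero])
  filter_upwards [h] with V' hV' hrough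
  have h0 : transportK (avOfRecord F N p.K 0).avg (fun _ => (0 : ℝ)) V' = 0 := by
    show kernelTransport _ _ _ (fun _ => (0 : ℝ)) V' = 0
    simp only [kernelTransport, integral_zero, mul_zero]
  have h1 : transportK (avOfRecord F N p.K 0).avg
      (fun U => (if PlaqSmall (2 * α₀ * (((F.P p.K).L : ℝ) ^ 1 * (F.P p.K).eta 1) ^ 2) V' then (0 : ℝ) else 1) *
        (wOfRecord F N ν τ.M A₁ ζ p g 0 s' U V' * (chiSeqOfRecord F N ν τ.M g p.K 0 s'.init U * slotsOfRecord F N ν τ E (wOfRecord F N ν τ.M A₁ ζ) ppSel p g 0 s'.init U))) V' =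
      slotsTOfRecord F N ν τ E (wOfRecord F N ν τ.M A₁ ζ) ppSel p g 1 s' V' := by
    rw [slotsTOfRecord_succ_apply]
    simp only [hrough, if_false, one_mul]
    rfl
  rw [← h1, hV', h0]

end SlotOnRough

/-! ## §3. The rough all-(3.2)-small set is NON-NULL once ONE coarse field is strictly `2εreg`-rough near every χ₁-cube (open set · unit branch · open-positivity of `dV′`) -/

section RoughWitness

variable (ν : Stage7Numerics) (M : ℕ) (p : B12.RunParams) (g : ℕ → ℝ)

/-- **ON A CUBE-ROUGH COARSE FIELD `χ₁(s′) = a(∅) = 1` AT EVERY `s′` WITH `Ω₁(s′) = 𝕋`** (unit branch: a `2εreg`-rough cornered plaquette rules out every (2.12) minimiser on `□′^{∼4}` —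
g8's `not_solvable_of_roughAt` — so def-R's localized background is `1` and the (3.2) factor of `□′` is `1` — g8's `chiFactor_eq_one_of_not_solvable`; `εreg` in [B7] Prop. 2's range, grid
`3·L·M₁ ≤ sideχ`, `1 ≤ M₁`, `1 ≤ m+K`, `0 < ε₁η₁²`). [cite: Balaban1988Convergent, (3.2) p.265, (2.12) p.256, (2.16)–(2.17) p.257; Balaban1985Averaging, Prop. 2 (54) p.26] -/
theorem chiSeqOfRecord_one_eq_one_of_cubeRough (hε₁ : 0 < epsOfRecord ν g 1 * (F.P p.K).eta 1 ^ 2) (hmK : 1 ≤ (F.P p.K).m + (F.P p.K).K) (hε : 0 < ν.εreg)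
    (hε3 : (143 * (((((F.P p.K).d + 4 : ℕ) : ℝ)) ^ 2 / 4) ^ 2) * ν.εreg ≤ 1 / 3)
    (hε2 : 2 * ν.εreg ≤ 2 * deltaSU (Fin N) / ((((F.P p.K).d + 4) * (F.P p.K).L : ℕ) : ℝ) ^ 2)
    (hM1 : 1 ≤ ν.M₁) (h3 : 3 * side (F.P p.K).L ν.M₁ 1 ≤ sideχ F ν p g 0)
    (s' : SeqOfRecord F ν M g p.K 1) (hΩ : s'.Ω 1 = Set.univ) (V' : GaugeField (F.P p.K) 1 (SU N))
    (hV : ∀ c : Iχ F ν p g 0, ∃ q : Plaq (F.P p.K) 1,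
      q.src ∈ pts 1 (cubeEnl (F.P p.K) (sideχ F ν p g 0) c 3) ∧ q.src.shift q.μ ∈ pts 1 (cubeEnl (F.P p.K) (sideχ F ν p g 0) c 3) ∧
        q.src.shift q.ν ∈ pts 1 (cubeEnl (F.P p.K) (sideχ F ν p g 0) c 3) ∧ 2 * ν.εreg ≤ dist1 (plaqHol V' q)) :
    chiSeqOfRecord F N ν M g p.K 1 s' V' = 1 := by
  rw [chiSeqOfRecord_succ_top_eq_prod F N ν M p g 0 s' hΩ V']
  exact Finset.prod_eq_one fun c _ => (hV c).elim fun q h => BalabanUVNodesN11AllSmallEmptyExtUnitBranch.chiFactor_eq_one_of_not_solvable ν p g 0 hε₁ c V'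
    (BalabanUVNodesN11AllSmallEmptyExtUnitBranch.not_solvable_of_roughAt ν p g 0 hmK hε hε3 hε2 hM1 h3 c V' h.1 h.2.1 h.2.2.1 h.2.2.2)

/-- **… AND IT IS ROUGH AT EVERY THRESHOLD `t ≤ 2εreg`** (the rough cornered plaquette of any one cube `□′₀`). [cite: Balaban1987RG1, (0.18) p.255; Balaban1988Convergent, (2.12) p.256] -/
theorem not_plaqSmall_of_cubeRough {t : ℝ} (ht : t ≤ 2 * ν.εreg) (c₀ : Iχ F ν p g 0) (V' : GaugeField (F.P p.K) 1 (SU N))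
    (hV : ∀ c : Iχ F ν p g 0, ∃ q : Plaq (F.P p.K) 1,
      q.src ∈ pts 1 (cubeEnl (F.P p.K) (sideχ F ν p g 0) c 3) ∧ q.src.shift q.μ ∈ pts 1 (cubeEnl (F.P p.K) (sideχ F ν p g 0) c 3) ∧
        q.src.shift q.ν ∈ pts 1 (cubeEnl (F.P p.K) (sideχ F ν p g 0) c 3) ∧ 2 * ν.εreg ≤ dist1 (plaqHol V' q)) :
    ¬ PlaqSmall t V' := by
  exact fun hs => (hV c₀).elim fun q h => not_lt.2 (ht.trans h.2.2.2) (hs q)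

/-- ★ **THE ROUGH ALL-(3.2)-SMALL SET `{V′ | χ₁(s′)V′ ≠ 0 ∧ ¬PlaqSmall t V′}` IS NON-NULL ONCE ONE STRICTLY CUBE-ROUGH COARSE FIELD EXISTS** (`t ≤ 2εreg`; the witness is DISPLAYED —
cf. `exists_cubeRoughStrict_of_lt_dist1`): g5's open set `…N11SmallRegFirstStepFails.isOpen_cubeRoughCoarse_lt` is then non-empty, hence of positive product-Haar measure
(`B12ContinuousTransportInvariance.isOpenPosMeasure_fieldMeasure_SU`), and it lies inside the rough all-(3.2)-small set by the two lemmas above.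
[cite: Balaban1988Convergent, (3.2) p.265, (2.12) p.256; Balaban1985Averaging, (10) p.19, Prop. 2 (54) p.26] -/
theorem rough_support_ne_zero_of_exists_cubeRoughStrict (hε₁ : 0 < epsOfRecord ν g 1 * (F.P p.K).eta 1 ^ 2) (hmK : 1 ≤ (F.P p.K).m + (F.P p.K).K)
    (hε : 0 < ν.εreg) (hε3 : (143 * (((((F.P p.K).d + 4 : ℕ) : ℝ)) ^ 2 / 4) ^ 2) * ν.εreg ≤ 1 / 3)
    (hε2 : 2 * ν.εreg ≤ 2 * deltaSU (Fin N) / ((((F.P p.K).d + 4) * (F.P p.K).L : ℕ) : ℝ) ^ 2)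
    (hM1 : 1 ≤ ν.M₁) (h3 : 3 * side (F.P p.K).L ν.M₁ 1 ≤ sideχ F ν p g 0) {t : ℝ} (ht : t ≤ 2 * ν.εreg) (c₀ : Iχ F ν p g 0)
    (s' : SeqOfRecord F ν M g p.K 1) (hΩ : s'.Ω 1 = Set.univ)
    (hex : ∃ V₀ : GaugeField (F.P p.K) 1 (SU N), ∀ c : Iχ F ν p g 0, ∃ q : Plaq (F.P p.K) 1,
      q.src ∈ pts 1 (cubeEnl (F.P p.K) (sideχ F ν p g 0) c 3) ∧ q.src.shift q.μ ∈ pts 1 (cubeEnl (F.P p.K) (sideχ F ν p g 0) c 3) ∧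
        q.src.shift q.ν ∈ pts 1 (cubeEnl (F.P p.K) (sideχ F ν p g 0) c 3) ∧ 2 * ν.εreg < dist1 (plaqHol V₀ q)) :
    fieldMeasure (F.P p.K) 1 (SU N) {V' | chiSeqOfRecord F N ν M g p.K 1 s' V' ≠ 0 ∧ ¬ PlaqSmall t V'} ≠ 0 := by
  haveI := B12ContinuousTransportInvariance.isOpenPosMeasure_fieldMeasure_SU N (F.P p.K) 1
  have hpos := (BalabanUVNodesN11SmallRegFirstStepFails.isOpen_cubeRoughCoarse_lt ν p g (2 * ν.εreg)).measure_pos (fieldMeasure (F.P p.K) 1 (SU N)) hex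
  refine (lt_of_lt_of_le hpos (measure_mono fun V' hV' => ?_)).ne'
  refine ⟨?_, not_plaqSmall_of_cubeRough ν p g ht c₀ V' fun c => (hV' c).imp fun q h => ⟨h.1, h.2.1, h.2.2.1, h.2.2.2.le⟩⟩
  rw [chiSeqOfRecord_one_eq_one_of_cubeRough ν M p g hε₁ hmK hε hε3 hε2 hM1 h3 s' hΩ V' fun c => (hV' c).imp fun q h => ⟨h.1, h.2.1, h.2.2.1, h.2.2.2.le⟩]
  exact one_ne_zero

/-- ★ **… AND SUCH A FIELD EXISTS AS SOON AS `SU(N)` HAS AN ELEMENT AT DISTANCE `> t` FROM `1`** (`1 ≤ M₂`): g5's positivity theorem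
`…N11SmallRegFirstStepFails.fieldMeasure_cubeRough_inter_preimage_pos` (the alternating coarse field's face section and [I] (0.4)'s continuous averaging near it) makes the
fine fields with a cornered-`t′`-rough AVERAGE a `dU`-non-null event for any `t < t′ < dist1 g₀`; any member's average is the witness.
[cite: Balaban1987RG1, (0.3)–(0.4) pp.252–253; Balaban1985Averaging, (9)–(10) p.19; Balaban1988Convergent, (2.17) p.257, (3.2) p.265] -/
theorem exists_cubeRoughStrict_of_lt_dist1 (hM₂ : 1 ≤ ν.M₂) (g₀ : SU N) {t : ℝ} (ht : t < dist1 g₀) :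
    ∃ V₀ : GaugeField (F.P p.K) 1 (SU N), ∀ c : Iχ F ν p g 0, ∃ q : Plaq (F.P p.K) 1,
      q.src ∈ pts 1 (cubeEnl (F.P p.K) (sideχ F ν p g 0) c 3) ∧ q.src.shift q.μ ∈ pts 1 (cubeEnl (F.P p.K) (sideχ F ν p g 0) c 3) ∧
        q.src.shift q.ν ∈ pts 1 (cubeEnl (F.P p.K) (sideχ F ν p g 0) c 3) ∧ t < dist1 (plaqHol V₀ q) := by
  have ht' : (t + dist1 g₀) / 2 < dist1 g₀ := by linarith
  obtain ⟨U, -, hU⟩ := nonempty_of_measure_ne_zero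
    (BalabanUVNodesN11SmallRegFirstStepFails.fieldMeasure_cubeRough_inter_preimage_pos F N ν p g hM₂ g₀ ht' ht').ne'
  exact ⟨(avOfRecord F N p.K 0).avg U, fun c => (hU c).imp fun q h => ⟨h.1, h.2.1, h.2.2.1, lt_of_lt_of_le (by linarith) h.2.2.2⟩⟩

end RoughWitness

/-! ## §4. (O3′) at the top pair tests the new-side prefactor on the rough part of the support; at `rePinH θ` the test is a trichotomy -/

section Test

variable (θ : Stage13HParams F N) (p : B12.RunParams)

/-- ★★★ **(O3′) AT THE TOP PAIR ⇒ THE NEW-SIDE PREFACTOR VANISHES a.e. ON THE ROUGH PART OF THE SUPPORT** (or the 𝐓-slot is the zero function): at the Stage-13 record (`1 ≤ M`, `0 < M₂`,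
`0 < K`, the `α₀` guards and `ε₁η₁² + 8δ₀ ≤ α₀η₁²`), for `s′ = (𝕋, 𝕋)` and any first-step terms `(u₁, e₁)`, clause (iii) of `FirstStepClausesAt θ p s′ u₁ e₁` implies
`slotT_1(s′) = 0 ∨ ∀ᵐ V′, χ₁(s′)V′ ≠ 0 → ¬PlaqSmall(2α₀(Lη₁)²) V′ → ζ_0(∅)(base₁V′)·w_0(𝕋,∅,∅)(base₁V′) = 0` (the exponential never vanishes). [cite: Balaban1988Convergent, Thm 1 p.262, (3.1) p.264, (3.25) p.270; Balaban1985Averaging, Prop. 2 (53) p.26; Balaban1987RG1, Thm 1 p.259] -/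
theorem top_prefactor_ae_zero_on_rough_of_O3 (hM : 1 ≤ θ.τ9.M) (hM₂ : 0 < θ.ν.M₂) (hK : 0 < p.K) {α₀ : ℝ} (hα : 0 < α₀)
    (hα3 : (143 * (((((F.P p.K).d + 4 : ℕ) : ℝ)) ^ 2 / 4) ^ 2) * α₀ ≤ 1 / 3)
    (hα2 : 2 * α₀ ≤ 2 * deltaSU (Fin N) / ((((F.P p.K).d + 4) * (F.P p.K).L : ℕ) : ℝ) ^ 2)
    (hαε : epsOfRecord θ.ν (gOfRecord₁₃ F N θ.toStage13Params p) 1 * (F.P p.K).eta 1 ^ 2 + 4 * (2 * deltaOfRecord θ.ν (gOfRecord₁₃ F N θ.toStage13Params p) 0 θ.A₁) ≤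
      α₀ * (F.P p.K).eta 1 ^ 2)
    (s' : SeqOfRecord F θ.ν θ.τ9.M (gOfRecord₁₃ F N θ.toStage13Params p) p.K 1) (hΩ : s'.Ω 1 = Set.univ) (hΛ : s'.Λ 1 = Set.univ)
    (u₁ : Sect2.TermValues (F.P p.K) (MatA N) (FluctV N) θ.τ9.M) (e₁ : ℝ)
    (hO3 : slotsTOfRecord F N θ.ν θ.τ9 (EOfRecord₁₃ F N θ.toStage13Params) (wOfRecord₉ F N θ.toStage9Params) θ.ppSel p (gOfRecord₁₃ F N θ.toStage13Params p) 1 s' = 0 ∨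
      ∀ᵐ V' ∂fieldMeasure (F.P p.K) 1 (SU N),
        chiSeqOfRecord F N θ.ν θ.τ9.M (gOfRecord₁₃ F N θ.toStage13Params p) p.K 1 s' V' ≠ 0 →
          slotsTOfRecord F N θ.ν θ.τ9 (EOfRecord₁₃ F N θ.toStage13Params) (wOfRecord₉ F N θ.toStage9Params) θ.ppSel p (gOfRecord₁₃ F N θ.toStage13Params p) 1 s' V' =
            sect2Slot F N (FluctV N) p.K (settingOfRecord₁₃ F N θ.toStage13Params p) (θ.rzAt p s') (WtOfRecord₁₃H F N θ p s') s' u₁ e₁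
              (UbgOfRecord₁₃CoP F N θ.toStage13Params p 1 s') V') :
    slotsTOfRecord F N θ.ν θ.τ9 (EOfRecord₁₃ F N θ.toStage13Params) (wOfRecord₉ F N θ.toStage9Params) θ.ppSel p (gOfRecord₁₃ F N θ.toStage13Params p) 1 s' = 0 ∨
      ∀ᵐ V' ∂fieldMeasure (F.P p.K) 1 (SU N),
        chiSeqOfRecord F N θ.ν θ.τ9.M (gOfRecord₁₃ F N θ.toStage13Params p) p.K 1 s' V' ≠ 0 →
          ¬ PlaqSmall (2 * α₀ * (((F.P p.K).L : ℝ) ^ 1 * (F.P p.K).eta 1) ^ 2) V' →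
            (WtOfRecord₁₃H F N θ p s').ζ 0 ∅ (baseCfg (V := FluctV N) 1 V') * (WtOfRecord₁₃H F N θ p s').w 0 Set.univ ∅ ∅ (baseCfg (V := FluctV N) 1 V') = 0 := by
  rcases (firstStep_O3_top_iff θ p hM s' hΩ hΛ u₁ e₁).1 hO3 with h0 | hid
  · exact Or.inl h0
  · refine Or.inr ?_
    have hz := slotsT_one_top_ae_zero_on_rough θ.ν θ.τ9 (EOfRecord₁₃ F N θ.toStage13Params) θ.A₁ θ.ζ θ.ppSel p (gOfRecord₁₃ F N θ.toStage13Params p) hK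
      (sideD_pos θ.ν hM p _ 0) (sideχ_pos hM₂ p _ 0) hα hα3 hα2 hαε s' hΩ hΛ
    filter_upwards [hid, hz] with V' hV' hzV' hχ hrough
    have h1 := hV' hχ
    -- the old side vanishes at this `V′`, the new side is prefactor · exp(…): the prefactor vanishes
    have hlhs : slotsTOfRecord F N θ.ν θ.τ9 (EOfRecord₁₃ F N θ.toStage13Params) (wOfRecord₉ F N θ.toStage9Params) θ.ppSel p
        (gOfRecord₁₃ F N θ.toStage13Params p) 1 s' V' = 0 := hzV' hrough
    rw [BalabanUVNodesN11TopChildStepWeight.chiSeqOfRecord_succ_top_eq_prod F N θ.ν θ.τ9.M p (gOfRecord₁₃ F N θ.toStage13Params p) 0 s' hΩ V'] at hχ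
    rw [BalabanUVNodesN11TopChildTStep.slotsTOfRecord_succ_top_eq_of_chiSeq_ne_zero F N θ.ν θ.τ9 (EOfRecord₁₃ F N θ.toStage13Params) θ.A₁ θ.ζ θ.ppSel p
      (gOfRecord₁₃ F N θ.toStage13Params p) 0 (sideD_pos θ.ν hM p _ 0) s' hΩ hΛ V'
      (by rw [BalabanUVNodesN11TopChildStepWeight.chiSeqOfRecord_succ_top_eq_prod F N θ.ν θ.τ9.M p (gOfRecord₁₃ F N θ.toStage13Params p) 0 s' hΩ V']; exact hχ)] at hlhs
    have hfun : (fun U => chiPrime (sect3DataOfRecord F N θ.ν θ.τ9.M p (gOfRecord₁₃ F N θ.toStage13Params p) 0 s'.init) (avOfRecord F N p.K)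
          (2 * deltaOfRecord θ.ν (gOfRecord₁₃ F N θ.toStage13Params p) 0 θ.A₁) (Finset.univ : Finset (Iχ F θ.ν p (gOfRecord₁₃ F N θ.toStage13Params p) 0)) U V' *
        (∑ S : Finset (Iχ F θ.ν p (gOfRecord₁₃ F N θ.toStage13Params p) 0), θ.ζ p (gOfRecord₁₃ F N θ.toStage13Params p) 0 s'.init ∅ ∅ (∅, S) U V') *
        (chiSeqOfRecord F N θ.ν θ.τ9.M (gOfRecord₁₃ F N θ.toStage13Params p) p.K 0 s'.init U *
          slotsOfRecord F N θ.ν θ.τ9 (EOfRecord₁₃ F N θ.toStage13Params) (wOfRecord₉ F N θ.toStage9Params) θ.ppSel p (gOfRecord₁₃ F N θ.toStage13Params p) 0 s'.init U)) =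
      fun U => chiPrime (sect3DataOfRecord F N θ.ν θ.τ9.M p (gOfRecord₁₃ F N θ.toStage13Params p) 0 s'.init) (avOfRecord F N p.K)
          (2 * deltaOfRecord θ.ν (gOfRecord₁₃ F N θ.toStage13Params p) 0 θ.A₁) (Finset.univ : Finset (Iχ F θ.ν p (gOfRecord₁₃ F N θ.toStage13Params p) 0)) U V' *
        (∑ S : Finset (Iχ F θ.ν p (gOfRecord₁₃ F N θ.toStage13Params p) 0), θ.ζ p (gOfRecord₁₃ F N θ.toStage13Params p) 0 s'.init ∅ ∅ (∅, S) U V') *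
        rhoZeroOfRecord F N p.K (gOfRecord₁₃ F N θ.toStage13Params p 0) (EOfRecord₁₃ F N θ.toStage13Params p) U := by
      funext U
      rw [chiSeqOfRecord_zero, one_mul, BalabanUVNodesN11FirstStepSupply.slotsOfRecord₁₃H_zero_eq_rhoZero]
    rw [hfun] at hlhs
    rw [hlhs] at h1
    -- `0 = prefactor · exp(…)`
    have hexp := Real.exp_pos ((sect2ActionDataOfRecord F N (FluctV N) p.K (settingOfRecord₁₃ F N θ.toStage13Params p) (θ.rzAt p s') s' u₁ (fun _ => ∅, fun _ => 0) e₁).action23 1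
      (UbgOfRecord₁₃CoP F N θ.toStage13Params p 1 s' (fun j => ((baseCfg (V := FluctV N) 1 V') j).1)))
    rcases mul_eq_zero.1 h1.symm with h2 | h2
    · exact h2
    · exact absurd h2 hexp.ne'

/-- ★★★ **AT `rePinH θ` THE TEST IS A TRICHOTOMY**: the prefactor is the CONSTANT `c₀ · 1`, `c₀ = 1 − w_0(s′^{all-large}_1)(1, 1̄)`; so (O3′) at the top pair of `rePinH θ` implies
`slotT_1(s′) ≡ 0 ∨ c₀ = 0 ∨ {V′ | χ₁(s′)V′ ≠ 0 ∧ ¬PlaqSmall(2α₀(Lη₁)²) V′}` is `dV′`-null. [cite: Balaban1988Convergent, Thm 1 p.262, (3.1)–(3.5) pp.264–265, (1.11) p.248; Balaban1985Averaging, Prop. 2 (53) p.26] -/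
theorem rePinH_top_O3_trichotomy (hM : 1 ≤ θ.τ9.M) (hM₂ : 0 < θ.ν.M₂) (hK : 0 < p.K) {α₀ : ℝ} (hα : 0 < α₀)
    (hα3 : (143 * (((((F.P p.K).d + 4 : ℕ) : ℝ)) ^ 2 / 4) ^ 2) * α₀ ≤ 1 / 3)
    (hα2 : 2 * α₀ ≤ 2 * deltaSU (Fin N) / ((((F.P p.K).d + 4) * (F.P p.K).L : ℕ) : ℝ) ^ 2)
    (hαε : epsOfRecord θ.ν (gOfRecord₁₃ F N θ.toStage13Params p) 1 * (F.P p.K).eta 1 ^ 2 + 4 * (2 * deltaOfRecord θ.ν (gOfRecord₁₃ F N θ.toStage13Params p) 0 θ.A₁) ≤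
      α₀ * (F.P p.K).eta 1 ^ 2)
    (s' : SeqOfRecord F θ.ν θ.τ9.M (gOfRecord₁₃ F N θ.toStage13Params p) p.K 1) (hΩ : s'.Ω 1 = Set.univ) (hΛ : s'.Λ 1 = Set.univ)
    (u₁ : Sect2.TermValues (F.P p.K) (MatA N) (FluctV N) θ.τ9.M) (e₁ : ℝ)
    (hO3 : slotsTOfRecord F N θ.ν θ.τ9 (EOfRecord₁₃ F N θ.toStage13Params) (wOfRecord₉ F N θ.toStage9Params) θ.ppSel p (gOfRecord₁₃ F N θ.toStage13Params p) 1 s' = 0 ∨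
      ∀ᵐ V' ∂fieldMeasure (F.P p.K) 1 (SU N),
        chiSeqOfRecord F N θ.ν θ.τ9.M (gOfRecord₁₃ F N θ.toStage13Params p) p.K 1 s' V' ≠ 0 →
          slotsTOfRecord F N θ.ν θ.τ9 (EOfRecord₁₃ F N θ.toStage13Params) (wOfRecord₉ F N θ.toStage9Params) θ.ppSel p (gOfRecord₁₃ F N θ.toStage13Params p) 1 s' V' =
            sect2Slot F N (FluctV N) p.K (settingOfRecord₁₃ F N θ.toStage13Params p) ((rePinH θ).rzAt p s') (WtOfRecord₁₃H F N (rePinH θ) p s') s' u₁ e₁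
              (UbgOfRecord₁₃CoP F N θ.toStage13Params p 1 s') V') :
    slotsTOfRecord F N θ.ν θ.τ9 (EOfRecord₁₃ F N θ.toStage13Params) (wOfRecord₉ F N θ.toStage9Params) θ.ppSel p (gOfRecord₁₃ F N θ.toStage13Params p) 1 s' = 0 ∨
      (1 - wOfRecord₉ F N θ.toStage9Params p (gOfRecord₁₃ F N θ.toStage13Params p) 0
          (seqAllLargeOfRecord F θ.ν θ.τ9.M (gOfRecord₁₃ F N θ.toStage13Params p) p.K 1) (fun _ => 1) ((avOfRecord F N p.K 0).avg fun _ => 1) = 0) ∨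
      fieldMeasure (F.P p.K) 1 (SU N) {V' | chiSeqOfRecord F N θ.ν θ.τ9.M (gOfRecord₁₃ F N θ.toStage13Params p) p.K 1 s' V' ≠ 0 ∧
        ¬ PlaqSmall (2 * α₀ * (((F.P p.K).L : ℝ) ^ 1 * (F.P p.K).eta 1) ^ 2) V'} = 0 := by
  rcases top_prefactor_ae_zero_on_rough_of_O3 (rePinH θ) p hM hM₂ hK hα hα3 hα2 hαε s' hΩ hΛ u₁ e₁ hO3 with h0 | hae
  · exact Or.inl h0
  · by_cases hc : 1 - wOfRecord₉ F N θ.toStage9Params p (gOfRecord₁₃ F N θ.toStage13Params p) 0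
        (seqAllLargeOfRecord F θ.ν θ.τ9.M (gOfRecord₁₃ F N θ.toStage13Params p) p.K 1) (fun _ => 1) ((avOfRecord F N p.K 0).avg fun _ => 1) = 0
    · exact Or.inr (Or.inl hc)
    · refine Or.inr (Or.inr ?_)
      have h2 : ∀ᵐ V' ∂fieldMeasure (F.P p.K) 1 (SU N), ¬ (chiSeqOfRecord F N θ.ν θ.τ9.M (gOfRecord₁₃ F N θ.toStage13Params p) p.K 1 s' V' ≠ 0 ∧
          ¬ PlaqSmall (2 * α₀ * (((F.P p.K).L : ℝ) ^ 1 * (F.P p.K).eta 1) ^ 2) V') := by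
        filter_upwards [hae] with V' hV' hboth
        have h3 := hV' hboth.1 hboth.2
        rw [WtOfRecord₁₃H_rePinH_ζ_zero_empty_baseCfg θ p hK s' hΩ V', WtOfRecord₁₃H_rePinH_w_univ_empty θ p s' 0, mul_one] at h3
        exact hc h3
      have h4 := ae_iff.1 h2
      simp only [not_not] at h4
      exact h4

/-- ★★★ **THE MAIN TERM IS ABSENT AT `rePinH θ` WHEN THE ROUGH ALL-(3.2)-SMALL COARSE FIELDS ARE NON-NULL** (displayed): if `{V′ | χ₁(s′)V′ ≠ 0 ∧ ¬PlaqSmall(2α₀(Lη₁)²) V′}` has positive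
`dV′`-measure, then (O3′) at the top pair of `rePinH θ` implies that its 𝐓-slot is the zero function or vanishes a.e. on its support (`c₀ = 0` makes the §2-form slot the zero function,
`…OmegaTopAtRePinH.sect2Slot_rePinH_top_pair_eq`). [cite: Balaban1988Convergent, Thm 1 p.262, (3.1)–(3.5) pp.264–265, (3.25) p.270, (1.11) p.248; Balaban1985Averaging, Prop. 2 (53) p.26] -/
theorem rePinH_main_term_absent_of_O3 (hM : 1 ≤ θ.τ9.M) (hM₂ : 0 < θ.ν.M₂) (hK : 0 < p.K) {α₀ : ℝ} (hα : 0 < α₀)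
    (hα3 : (143 * (((((F.P p.K).d + 4 : ℕ) : ℝ)) ^ 2 / 4) ^ 2) * α₀ ≤ 1 / 3)
    (hα2 : 2 * α₀ ≤ 2 * deltaSU (Fin N) / ((((F.P p.K).d + 4) * (F.P p.K).L : ℕ) : ℝ) ^ 2)
    (hαε : epsOfRecord θ.ν (gOfRecord₁₃ F N θ.toStage13Params p) 1 * (F.P p.K).eta 1 ^ 2 + 4 * (2 * deltaOfRecord θ.ν (gOfRecord₁₃ F N θ.toStage13Params p) 0 θ.A₁) ≤
      α₀ * (F.P p.K).eta 1 ^ 2)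
    (s' : SeqOfRecord F θ.ν θ.τ9.M (gOfRecord₁₃ F N θ.toStage13Params p) p.K 1) (hΩ : s'.Ω 1 = Set.univ) (hΛ : s'.Λ 1 = Set.univ)
    (u₁ : Sect2.TermValues (F.P p.K) (MatA N) (FluctV N) θ.τ9.M) (e₁ : ℝ)
    (hR : fieldMeasure (F.P p.K) 1 (SU N) {V' | chiSeqOfRecord F N θ.ν θ.τ9.M (gOfRecord₁₃ F N θ.toStage13Params p) p.K 1 s' V' ≠ 0 ∧
        ¬ PlaqSmall (2 * α₀ * (((F.P p.K).L : ℝ) ^ 1 * (F.P p.K).eta 1) ^ 2) V'} ≠ 0)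
    (hO3 : slotsTOfRecord F N θ.ν θ.τ9 (EOfRecord₁₃ F N θ.toStage13Params) (wOfRecord₉ F N θ.toStage9Params) θ.ppSel p (gOfRecord₁₃ F N θ.toStage13Params p) 1 s' = 0 ∨
      ∀ᵐ V' ∂fieldMeasure (F.P p.K) 1 (SU N),
        chiSeqOfRecord F N θ.ν θ.τ9.M (gOfRecord₁₃ F N θ.toStage13Params p) p.K 1 s' V' ≠ 0 →
          slotsTOfRecord F N θ.ν θ.τ9 (EOfRecord₁₃ F N θ.toStage13Params) (wOfRecord₉ F N θ.toStage9Params) θ.ppSel p (gOfRecord₁₃ F N θ.toStage13Params p) 1 s' V' =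
            sect2Slot F N (FluctV N) p.K (settingOfRecord₁₃ F N θ.toStage13Params p) ((rePinH θ).rzAt p s') (WtOfRecord₁₃H F N (rePinH θ) p s') s' u₁ e₁
              (UbgOfRecord₁₃CoP F N θ.toStage13Params p 1 s') V') :
    slotsTOfRecord F N θ.ν θ.τ9 (EOfRecord₁₃ F N θ.toStage13Params) (wOfRecord₉ F N θ.toStage9Params) θ.ppSel p (gOfRecord₁₃ F N θ.toStage13Params p) 1 s' = 0 ∨
      ∀ᵐ V' ∂fieldMeasure (F.P p.K) 1 (SU N),
        chiSeqOfRecord F N θ.ν θ.τ9.M (gOfRecord₁₃ F N θ.toStage13Params p) p.K 1 s' V' ≠ 0 →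
          slotsTOfRecord F N θ.ν θ.τ9 (EOfRecord₁₃ F N θ.toStage13Params) (wOfRecord₉ F N θ.toStage9Params) θ.ppSel p (gOfRecord₁₃ F N θ.toStage13Params p) 1 s' V' = 0 := by
  rcases rePinH_top_O3_trichotomy θ p hM hM₂ hK hα hα3 hα2 hαε s' hΩ hΛ u₁ e₁ hO3 with h0 | hc | hnull
  · exact Or.inl h0
  · rcases hO3 with h0 | hid
    · exact Or.inl h0
    · refine Or.inr ?_
      filter_upwards [hid] with V' hV' hχ
      rw [hV' hχ, BalabanUVNodesN11OmegaTopAtRePinH.sect2Slot_rePinH_top_pair_eq θ p hK s' hΩ hΛ _ _ u₁ e₁ _ V', hc, zero_mul]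
  · exact absurd hnull hR

/-- ★★★ **THE MAIN TERM IS ABSENT AT `rePinH θ` AS SOON AS ONE STRICTLY `2εreg`-ROUGH-NEAR-EVERY-χ₁-CUBE COARSE FIELD EXISTS** (`2α₀(Lη₁)² ≤ 2εreg`, `εreg` in [B7] Prop. 2's range, grid
`3·L·M₁ ≤ sideχ`, `1 ≤ M₁`, `1 ≤ m+K`, `0 < ε₁η₁²`; the witness `V₀` and one cube `□′₀` displayed): §3 discharges the non-nullity letter `hR` of `rePinH_main_term_absent_of_O3`.
[cite: Balaban1988Convergent, Thm 1 p.262, (3.1)–(3.5) pp.264–265, (3.25) p.270, (2.12) p.256; Balaban1985Averaging, Prop. 2 (53)–(54) p.26, (10) p.19] -/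
theorem rePinH_main_term_absent_of_O3_of_exists_cubeRoughStrict (hM : 1 ≤ θ.τ9.M) (hM₂ : 0 < θ.ν.M₂) (hK : 0 < p.K) {α₀ : ℝ} (hα : 0 < α₀)
    (hα3 : (143 * (((((F.P p.K).d + 4 : ℕ) : ℝ)) ^ 2 / 4) ^ 2) * α₀ ≤ 1 / 3)
    (hα2 : 2 * α₀ ≤ 2 * deltaSU (Fin N) / ((((F.P p.K).d + 4) * (F.P p.K).L : ℕ) : ℝ) ^ 2)
    (hαε : epsOfRecord θ.ν (gOfRecord₁₃ F N θ.toStage13Params p) 1 * (F.P p.K).eta 1 ^ 2 + 4 * (2 * deltaOfRecord θ.ν (gOfRecord₁₃ F N θ.toStage13Params p) 0 θ.A₁) ≤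
      α₀ * (F.P p.K).eta 1 ^ 2)
    (hαr : 2 * α₀ * (((F.P p.K).L : ℝ) ^ 1 * (F.P p.K).eta 1) ^ 2 ≤ 2 * θ.ν.εreg)
    (hε₁ : 0 < epsOfRecord θ.ν (gOfRecord₁₃ F N θ.toStage13Params p) 1 * (F.P p.K).eta 1 ^ 2) (hmK : 1 ≤ (F.P p.K).m + (F.P p.K).K) (hε : 0 < θ.ν.εreg)
    (hε3 : (143 * (((((F.P p.K).d + 4 : ℕ) : ℝ)) ^ 2 / 4) ^ 2) * θ.ν.εreg ≤ 1 / 3)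
    (hε2 : 2 * θ.ν.εreg ≤ 2 * deltaSU (Fin N) / ((((F.P p.K).d + 4) * (F.P p.K).L : ℕ) : ℝ) ^ 2)
    (hM1 : 1 ≤ θ.ν.M₁) (h3 : 3 * side (F.P p.K).L θ.ν.M₁ 1 ≤ sideχ F θ.ν p (gOfRecord₁₃ F N θ.toStage13Params p) 0)
    (c₀ : Iχ F θ.ν p (gOfRecord₁₃ F N θ.toStage13Params p) 0)
    (hex : ∃ V₀ : GaugeField (F.P p.K) 1 (SU N), ∀ c : Iχ F θ.ν p (gOfRecord₁₃ F N θ.toStage13Params p) 0, ∃ q : Plaq (F.P p.K) 1,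
      q.src ∈ pts 1 (cubeEnl (F.P p.K) (sideχ F θ.ν p (gOfRecord₁₃ F N θ.toStage13Params p) 0) c 3) ∧
        q.src.shift q.μ ∈ pts 1 (cubeEnl (F.P p.K) (sideχ F θ.ν p (gOfRecord₁₃ F N θ.toStage13Params p) 0) c 3) ∧
          q.src.shift q.ν ∈ pts 1 (cubeEnl (F.P p.K) (sideχ F θ.ν p (gOfRecord₁₃ F N θ.toStage13Params p) 0) c 3) ∧ 2 * θ.ν.εreg < dist1 (plaqHol V₀ q))
    (s' : SeqOfRecord F θ.ν θ.τ9.M (gOfRecord₁₃ F N θ.toStage13Params p) p.K 1) (hΩ : s'.Ω 1 = Set.univ) (hΛ : s'.Λ 1 = Set.univ)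
    (u₁ : Sect2.TermValues (F.P p.K) (MatA N) (FluctV N) θ.τ9.M) (e₁ : ℝ)
    (hO3 : slotsTOfRecord F N θ.ν θ.τ9 (EOfRecord₁₃ F N θ.toStage13Params) (wOfRecord₉ F N θ.toStage9Params) θ.ppSel p (gOfRecord₁₃ F N θ.toStage13Params p) 1 s' = 0 ∨
      ∀ᵐ V' ∂fieldMeasure (F.P p.K) 1 (SU N),
        chiSeqOfRecord F N θ.ν θ.τ9.M (gOfRecord₁₃ F N θ.toStage13Params p) p.K 1 s' V' ≠ 0 →
          slotsTOfRecord F N θ.ν θ.τ9 (EOfRecord₁₃ F N θ.toStage13Params) (wOfRecord₉ F N θ.toStage9Params) θ.ppSel p (gOfRecord₁₃ F N θ.toStage13Params p) 1 s' V' =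
            sect2Slot F N (FluctV N) p.K (settingOfRecord₁₃ F N θ.toStage13Params p) ((rePinH θ).rzAt p s') (WtOfRecord₁₃H F N (rePinH θ) p s') s' u₁ e₁
              (UbgOfRecord₁₃CoP F N θ.toStage13Params p 1 s') V') :
    slotsTOfRecord F N θ.ν θ.τ9 (EOfRecord₁₃ F N θ.toStage13Params) (wOfRecord₉ F N θ.toStage9Params) θ.ppSel p (gOfRecord₁₃ F N θ.toStage13Params p) 1 s' = 0 ∨
      ∀ᵐ V' ∂fieldMeasure (F.P p.K) 1 (SU N),
        chiSeqOfRecord F N θ.ν θ.τ9.M (gOfRecord₁₃ F N θ.toStage13Params p) p.K 1 s' V' ≠ 0 →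
          slotsTOfRecord F N θ.ν θ.τ9 (EOfRecord₁₃ F N θ.toStage13Params) (wOfRecord₉ F N θ.toStage9Params) θ.ppSel p (gOfRecord₁₃ F N θ.toStage13Params p) 1 s' V' = 0 :=
  rePinH_main_term_absent_of_O3 θ p hM hM₂ hK hα hα3 hα2 hαε s' hΩ hΛ u₁ e₁
    (rough_support_ne_zero_of_exists_cubeRoughStrict θ.ν θ.τ9.M p (gOfRecord₁₃ F N θ.toStage13Params p) hε₁ hmK hε hε3 hε2 hM1 h3 hαr c₀ s' hΩ hex) hO3

end Test

end Summit.QuantumFields.YangMills.Theorems.BalabanUVNodesN11TopPairRoughSet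
end
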